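import Literature.MathematicalPhysics.QuantumFieldTheory.Balaban1983to89.B15Prop1CriticalChartFromIFT

/-!
# `Balaban1983to89.B15Prop1CriticalChartFromIFTRegular` — [Balaban1985Variational] = «[15]», Thm 1 p. 279, Sect. G pp. 305–309, Prop. 9 (190) p. 309 («analytic functions of B′»);
# [Balaban1989LargeFieldI] = «[IV]», Prop. 1 p. 194; [LuenbergerYe2008] §10.7:
# THE LOCAL HOLOMORPHIC MINIMISER CHART WITH ITS REGULARITY CLASS RECORDED — the `C^m` (any finite `m`) edition of
# `B15Prop1CriticalChartFromIFT.exists_localChart_of_criticalFamily_local`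

Honest framing: statement-level skeleton of published theorems with citation tags; proofs where landed; nothing here is a claim about the
Yang–Mills mass gap.  Cell `pub-ymgap`, HUMAN RULING D-0149 (width seats), seat `pub-ymgap-dag-n12-w1` (g2; N12 = [B15]; U1a⁺ of the w1 lineage);
count-neutral; N12 NOT discharged; finite 𝕋⁴ at fixed ε; nothing continuum ∕ OS ∕ mass-gap ∕ Clay.

WHY (dag-n12-c g17 LOCATED-REGULARITY, bus 2026-08-28T04:45Z).  The chart theorem `exists_localChart_of_criticalFamily_local` records only `DifferentiableOn ℂ` of the chart's entries
on its (multi-dimensional) complex domain; Mathlib has «ℂ-differentiable ⇒ smooth» only in ONE variable (no Hartogs∕Osgood), so consumers needing a REAL `C²` family (the (L2) side's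
letter (K′): `ContDiffAt ℝ 2` of the minimiser family in chart coordinates) cannot recover it from that clause.  The regularity EXISTS at the source: the implicit critical family `γ` of
`ConstrainedCriticalFamilyReal.exists_criticalFamily_real` is `ContDiffAt ℂ m` for the `m` of its hypotheses, and the state chart `χ` and datum coordinates `κ` of the N12 instance are
analytic.  THIS MODULE re-runs the chart theorem with `C^m` INPUTS for `χ`, `κ` (eventually near the base) and RECORDS the extra output clause
`∀ Q ∈ O, ∀ b i j, ContDiffAt ℂ m (fun Q => Γ Q b i j) Q` — repair (i) of the located note, at the generic level; the N12 instance at a base field follows by feeding the analytic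
`χ = expMulC · ↑U₀` and `κ` (`B15Prop1LocalChartAtBaseField`'s objects) with any finite `m ≠ 0` (successor ∕ n12-c: one application).

CONTENTS (theorems only; no `def`, no `instance`, no `sorry`).  `contDiffAt_entry`, ★★★ `exists_localChart_of_criticalFamily_local_contDiff`.
HONEST SCOPE: the same IFT bookkeeping as the v1.1 theorem with the regularity threaded through; nothing of Bałaban's asserted; count-neutral; N12 NOT discharged; the YM mass gap
(Clay) is NOT proved by any of this — R4 closes only the conditional finite-𝕋⁴ rung `BalabanLadder.UV`.
-/

noncomputable section

namespace Literature.MathematicalPhysics.QuantumFieldTheory.Balaban1983to89.B15Prop1CriticalChartFromIFTRegular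

open Set Metric Filter
open scoped Topology ContDiff ComplexConjugate
open Literature.Analysis.Calculus.ConstrainedCriticalFamily (exists_criticalFamily_real)
open Literature.MathematicalPhysics.QuantumFieldTheory.Balaban1983to89.Node00 (SU coeField coeField_apply)
open B15Prop1CriticalChartFromIFT (mem_specialUnitaryGroup_of_theta_fixed norm_entry_le_one_of_theta_fixed differentiable_entry)
open T4CubeChartGnomonic (SU2)
open T4Continuum B15DeterminingSets GaugeField
open scoped Matrix.Norms.L2Operator

/-- Matrix entries are `C^n` functions of the matrix (continuous linear). [cite: Balaban1989LargeFieldI, Prop. 1 p.194 (bookkeeping)] -/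
theorem contDiffAt_entry {n : WithTop ℕ∞} (i j : Fin 2) (A : Matrix (Fin 2) (Fin 2) ℂ) : ContDiffAt ℂ n (fun A : Matrix (Fin 2) (Fin 2) ℂ => A i j) A :=
  (LinearMap.toContinuousLinearMap (Matrix.entryLinearMap ℂ ℂ i j)).contDiff.contDiffAt

section ChartLocal

variable {P : Params}
  {E : Type*} [NormedAddCommGroup E] [NormedSpace ℂ E] [FiniteDimensional ℂ E]
  {F : Type*} [NormedAddCommGroup F] [NormedSpace ℂ F] [FiniteDimensional ℂ F]

/-- ★★★ **THE LOCAL HOLOMORPHIC MINIMISER CHART, `C^m` EDITION.**  Hypotheses as `B15Prop1CriticalChartFromIFT.exists_localChart_of_criticalFamily_local` (finite `m ≠ 0`), except that the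
state chart `χ` and the datum coordinates `κ` are asked `C^m` (not merely differentiable) near the base — true for the analytic N12 objects.  Conclusion: the same chart `(O, Γ)`
(entries ℂ-differentiable and bounded on `O`, values at real data are (2.12) minimisers) AND the recorded regularity `∀ Q ∈ O, ∀ b i j, ContDiffAt ℂ m (Γ · b i j) Q` — so every
REAL restriction of `Γ` along a `C^m` real family of data is `C^m` over `ℝ` (`ContDiffAt.restrict_scalars` + composition), which is what the (L2) side's family letter (K′) consumes
with `m = 2`. [cite: Balaban1985Variational, Thm 1 p.279, Sect. G pp.305–307, (181) p.307, Prop. 9 (190) p.309 («analytic functions of B′»); Balaban1989LargeFieldI, Prop. 1 p.194 (last clause); LuenbergerYe2008, §10.7 pp.306–307] -/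
theorem exists_localChart_of_criticalFamily_local_contDiff (av : ∀ j, Averaging P j SU2) (reg : Set (GaugeField P 0 SU2)) (𝔹 : DetSet P)
    (cE : E →L⋆[ℂ] E) (cF : F →L⋆[ℂ] F) (hcE : ∀ x, cE (cE x) = x) (hcF : ∀ y, cF (cF y) = y)
    {a : E → ℂ} {Φ : E → F} {x₀ : E} {ℓ₀ : F →L[ℂ] ℂ} {m : WithTop ℕ∞} (hm : m ≠ 0) (hm' : m ≠ (⊤ : ℕ∞))
    (ha : ContDiffAt ℂ (m + 1) a x₀) (hΦ : ContDiffAt ℂ (m + 1) Φ x₀)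
    (hcrit : fderiv ℂ a x₀ = ℓ₀.comp (fderiv ℂ Φ x₀))
    (honto : Function.Surjective (fderiv ℂ Φ x₀))
    (hnondeg : ∀ s : E, fderiv ℂ Φ x₀ s = 0 →
      (∀ t : E, fderiv ℂ Φ x₀ t = 0 → fderiv ℂ (fderiv ℂ a) x₀ s t - ℓ₀ (fderiv ℂ (fderiv ℂ Φ) x₀ s t) = 0) → s = 0)
    (haE : ∀ x, a (cE x) = conj (a x)) (hΦE : ∀ x, Φ (cE x) = cF (Φ x)) (hx₀ : cE x₀ = x₀)
    (χ : E → PBond P 0 → Matrix (Fin 2) (Fin 2) ℂ) (hχ : ∀ᶠ x in 𝓝 x₀, ContDiffAt ℂ m χ x)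
    (hχθ : ∀ x b, χ (cE x) b = (star (χ x b))⁻¹) (hχdet : ∀ x b, (χ x b).det = 1)
    (κ : (PBond P 0 → Matrix (Fin 2) (Fin 2) ℂ) → F) {Q₀ : GaugeField P 0 SU2} (hκ₀ : κ (coeField Q₀) = Φ x₀)
    (hκ : ∀ᶠ Q in 𝓝 (coeField Q₀), ContDiffAt ℂ m κ Q)
    (hκreal : ∀ᶠ Q in 𝓝 (coeField Q₀), ∀ Q' : GaugeField P 0 SU2, coeField Q' = Q → cF (κ Q) = κ Q)
    (Crit : GaugeField P 0 SU2 → GaugeField P 0 SU2 → Prop)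
    (htransfer : ∀ᶠ w in 𝓝 (x₀, coeField Q₀), ∀ (U' Q' : GaugeField P 0 SU2) (μ : F →L[ℂ] ℂ), χ w.1 = coeField U' → coeField Q' = w.2 →
      Φ w.1 = κ w.2 → fderiv ℂ a w.1 = μ.comp (fderiv ℂ Φ w.1) → (starL ℂ : ℂ ≃L⋆[ℂ] ℂ).toContinuousLinearMap.comp (μ.comp cF) = μ →
        U' ∈ reg ∧ AgreeOn 𝔹 (avgFamily av U') (avgFamily av Q') ∧ Crit Q' U')
    (hT1u : ∀ᶠ Q in 𝓝 (coeField Q₀), ∀ U' Q' : GaugeField P 0 SU2, coeField Q' = Q →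
      U' ∈ reg → AgreeOn 𝔹 (avgFamily av U') (avgFamily av Q') → Crit Q' U' → IsMinimizer av reg 𝔹 (avgFamily av Q') U')
    {𝓐₀ : ℝ} (h𝓐₀ : 1 < 𝓐₀) :
    ∃ O : Set (PBond P 0 → Matrix (Fin 2) (Fin 2) ℂ), IsOpen O ∧ coeField Q₀ ∈ O ∧
      ∃ Γ : (PBond P 0 → Matrix (Fin 2) (Fin 2) ℂ) → PBond P 0 → Matrix (Fin 2) (Fin 2) ℂ,
        (∀ b i j, DifferentiableOn ℂ (fun Q => Γ Q b i j) O) ∧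
        (∀ Q ∈ O, ∀ b i j, ContDiffAt ℂ m (fun Q => Γ Q b i j) Q) ∧
        (∀ Q ∈ O, ∀ b i j, ‖Γ Q b i j‖ ≤ 𝓐₀) ∧
        ∀ Q' : GaugeField P 0 SU2, coeField Q' ∈ O →
          ∃ U' : GaugeField P 0 SU2, (∀ b, Γ (coeField Q') b = ((U' b : SU2) : Matrix (Fin 2) (Fin 2) ℂ)) ∧
            IsMinimizer av reg 𝔹 (avgFamily av Q') U' := by
  -- the implicit critical family, real on real (with its multipliers)
  obtain ⟨γ, Λ, -, hγ0, -, hγc, -, hid, -, -, -, hreal⟩ :=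
    exists_criticalFamily_real hm ha hΦ hcrit honto hnondeg cE cF hcE hcF haE hΦE hx₀
  have hγ : ∀ᶠ g in 𝓝 (Φ x₀), Φ (γ g) = g ∧ ContDiffAt ℂ m γ g ∧
      fderiv ℂ a (γ g) = (Λ g).comp (fderiv ℂ Φ (γ g)) ∧
      (cF g = g → cE (γ g) = γ g ∧ (starL ℂ : ℂ ≃L⋆[ℂ] ℂ).toContinuousLinearMap.comp ((Λ g).comp cF) = Λ g) := by
    filter_upwards [hid, hγc.eventually hm', hreal] with g hg hcg hrg
    exact ⟨hg.1, hcg, hg.2, hrg⟩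
  have hγt : Tendsto γ (𝓝 (Φ x₀)) (𝓝 x₀) := by
    have h := hγc.continuousAt.tendsto
    rwa [hγ0] at h
  have hG : ∀ᶠ g in 𝓝 (Φ x₀), (Φ (γ g) = g ∧ ContDiffAt ℂ m γ g ∧
      fderiv ℂ a (γ g) = (Λ g).comp (fderiv ℂ Φ (γ g)) ∧
      (cF g = g → cE (γ g) = γ g ∧ (starL ℂ : ℂ ≃L⋆[ℂ] ℂ).toContinuousLinearMap.comp ((Λ g).comp cF) = Λ g)) ∧
      ContDiffAt ℂ m χ (γ g) := hγ.and (hγt.eventually hχ)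
  have hκc0 : ContDiffAt ℂ m κ (coeField Q₀) := hκ.self_of_nhds
  have hκt : Tendsto κ (𝓝 (coeField Q₀)) (𝓝 (Φ x₀)) := by
    have h := hκc0.continuousAt.tendsto
    rwa [hκ₀] at h
  -- the pair `(γ (κ Q), Q)` tends to `(x₀, ↑Q₀)`: pull the localised transfer back to `Q`
  have hpair : Tendsto (fun Q => (γ (κ Q), Q)) (𝓝 (coeField Q₀)) (𝓝 (x₀, coeField Q₀)) :=
    (hγt.comp hκt).prodMk_nhds tendsto_id
  have htrQ : ∀ᶠ Q in 𝓝 (coeField Q₀), ∀ (U' Q' : GaugeField P 0 SU2) (μ : F →L[ℂ] ℂ), χ (γ (κ Q)) = coeField U' → coeField Q' = Q →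
      Φ (γ (κ Q)) = κ Q → fderiv ℂ a (γ (κ Q)) = μ.comp (fderiv ℂ Φ (γ (κ Q))) →
        (starL ℂ : ℂ ≃L⋆[ℂ] ℂ).toContinuousLinearMap.comp (μ.comp cF) = μ →
          U' ∈ reg ∧ AgreeOn 𝔹 (avgFamily av U') (avgFamily av Q') ∧ Crit Q' U' :=
    hpair.eventually htransfer
  -- continuity of `Γ = χ ∘ γ ∘ κ` at the base datum and the entry bound there
  have hΓc : ContinuousAt (fun Q => χ (γ (κ Q))) (coeField Q₀) := by
    have h1 : ContinuousAt χ (γ (κ (coeField Q₀))) := by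
      rw [hκ₀, hγ0]; exact hχ.self_of_nhds.continuousAt
    have h2 : ContinuousAt γ (κ (coeField Q₀)) := by rw [hκ₀]; exact hγc.continuousAt
    have h3 : ContinuousAt (fun Q => γ (κ Q)) (coeField Q₀) := h2.comp hκc0.continuousAt
    exact ContinuousAt.comp (f := fun Q => γ (κ Q)) h1 h3
  have hbase : ∀ b i j, ‖χ (γ (κ (coeField Q₀))) b i j‖ < 𝓐₀ := fun b i j => by
    rw [hκ₀, hγ0]
    have hθ : χ x₀ b = (star (χ x₀ b))⁻¹ := by
      have h := hχθ x₀ b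
      rwa [hx₀] at h
    exact lt_of_le_of_lt (norm_entry_le_one_of_theta_fixed hθ (hχdet x₀ b) i j) h𝓐₀
  have hbound : ∀ᶠ Q in 𝓝 (coeField Q₀), ∀ b i j, ‖χ (γ (κ Q)) b i j‖ < 𝓐₀ := by
    refine eventually_all.2 fun b => eventually_all.2 fun i => eventually_all.2 fun j => ?_
    have hc : ContinuousAt (fun Q => ‖χ (γ (κ Q)) b i j‖) (coeField Q₀) :=
      ((continuous_apply j).continuousAt.comp ((continuous_apply i).continuousAt.comp
        ((continuous_apply b).continuousAt.comp hΓc))).norm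
    exact hc.eventually (gt_mem_nhds (hbase b i j))
  -- the good set of data and the open chart domain
  have hS : ∀ᶠ Q in 𝓝 (coeField Q₀), ContDiffAt ℂ m κ Q ∧ (∀ b i j, ‖χ (γ (κ Q)) b i j‖ < 𝓐₀) ∧
      (∀ Q' : GaugeField P 0 SU2, coeField Q' = Q → cF (κ Q) = κ Q) ∧
      (∀ U' Q' : GaugeField P 0 SU2, coeField Q' = Q →
        U' ∈ reg → AgreeOn 𝔹 (avgFamily av U') (avgFamily av Q') → Crit Q' U' → IsMinimizer av reg 𝔹 (avgFamily av Q') U') ∧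
      ((Φ (γ (κ Q)) = κ Q ∧ ContDiffAt ℂ m γ (κ Q) ∧
        fderiv ℂ a (γ (κ Q)) = (Λ (κ Q)).comp (fderiv ℂ Φ (γ (κ Q))) ∧
        (cF (κ Q) = κ Q → cE (γ (κ Q)) = γ (κ Q) ∧
          (starL ℂ : ℂ ≃L⋆[ℂ] ℂ).toContinuousLinearMap.comp ((Λ (κ Q)).comp cF) = Λ (κ Q))) ∧
        ContDiffAt ℂ m χ (γ (κ Q))) ∧
      (∀ (U' Q' : GaugeField P 0 SU2) (μ : F →L[ℂ] ℂ), χ (γ (κ Q)) = coeField U' → coeField Q' = Q →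
        Φ (γ (κ Q)) = κ Q → fderiv ℂ a (γ (κ Q)) = μ.comp (fderiv ℂ Φ (γ (κ Q))) →
          (starL ℂ : ℂ ≃L⋆[ℂ] ℂ).toContinuousLinearMap.comp (μ.comp cF) = μ →
            U' ∈ reg ∧ AgreeOn 𝔹 (avgFamily av U') (avgFamily av Q') ∧ Crit Q' U') :=
    hκ.and (hbound.and (hκreal.and (hT1u.and ((hκt.eventually hG).and htrQ))))
  obtain ⟨S, hSsub, hSopen, hSmem⟩ := _root_.mem_nhds_iff.1 hS
  -- the regularity of `Γ = χ ∘ γ ∘ κ` on `S`, entrywise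
  have hreg : ∀ Q ∈ S, ∀ b i j, ContDiffAt ℂ m (fun Q => χ (γ (κ Q)) b i j) Q := by
    intro Q hQ b i j
    obtain ⟨hκQ, -, -, -, ⟨⟨-, hγQ, -, -⟩, hχQ⟩, -⟩ := hSsub hQ
    have h : ContDiffAt ℂ m (fun Q => χ (γ (κ Q))) Q := hχQ.comp Q (hγQ.comp Q hκQ)
    have hb : ContDiffAt ℂ m (fun Q => χ (γ (κ Q)) b) Q := (contDiffAt_pi.1 h) b
    exact (contDiffAt_entry i j _).comp Q hb
  refine ⟨S, hSopen, hSmem, fun Q => χ (γ (κ Q)), fun b i j => ?_, hreg, fun Q hQ b i j => le_of_lt ((hSsub hQ).2.1 b i j), fun Q' hQ' => ?_⟩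
  · intro Q hQ
    exact ((hreg Q hQ b i j).differentiableAt hm).differentiableWithinAt
  · obtain ⟨-, -, hκr, hT, ⟨⟨hfib, -, hlag, hrealQ⟩, -⟩, htr⟩ := hSsub hQ'
    obtain ⟨hfix, hμ⟩ := hrealQ (hκr Q' rfl)
    have hmem : ∀ b, χ (γ (κ (coeField Q'))) b ∈ Matrix.specialUnitaryGroup (Fin 2) ℂ := fun b => by
      refine mem_specialUnitaryGroup_of_theta_fixed ?_ (hχdet _ b)
      have h := hχθ (γ (κ (coeField Q'))) b
      rwa [hfix] at h
    let U' : GaugeField P 0 SU2 := fun b => ⟨χ (γ (κ (coeField Q'))) b, hmem b⟩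
    have hU' : χ (γ (κ (coeField Q'))) = coeField U' := funext fun b => rfl
    obtain ⟨hreg', hagree, hcritQ⟩ := htr U' Q' (Λ (κ (coeField Q'))) hU' rfl hfib hlag hμ
    exact ⟨U', fun b => rfl, hT U' Q' rfl hreg' hagree hcritQ⟩

end ChartLocal

end Literature.MathematicalPhysics.QuantumFieldTheory.Balaban1983to89.B15Prop1CriticalChartFromIFTRegular

end
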